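import Summits.CriticalPhenomena.SAWScalingLimit.Theorems.BoundaryClosureNegative_Profile

/-!
# Negative knowledge on crux `HexObservableLimitR` (stmt-CriticalPhenomena-14003), mirror part 1:
the row-preserving reflection of the honeycomb lattice

The plane reflection `τ z = -conj z` (in the vertical axis) preserves the horizontal zigzag rows of the embedded
honeycomb lattice `hexCenter : HexVertex → ℂ`: it is induced by the lattice involution
`σ (fj j r) = fj (-j - 2r - 2) r` (`hexCenter_σ`), a graph automorphism of `hexGraph` (`adj_σ_iff`) fixing the row
coordinate `v.1 1` (`row_σ`).  Consequences recorded here: transport of vertex sets (`Finset.map σE`), of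
mid-edges and their midpoints (`hexMidpoint_map_σ`), of the domain mid-edges / boundary mid-edges
(`mem_hexDomainMidEdges_map_iff`, `mem_hexDomainBoundary_map_iff`), of connectivity of induced subgraphs
(`preconnected_induce_image_σ`) and hence of simple connectivity (`hexDomainSimplyConnected_map_σ`), and finiteness
of the set of domain mid-edges (`finite_hexDomainMidEdges`).  Used by `MirrorSAW.lean` (walks, windings, the
observable: `F ↦ conj F`) and `ConstReal.lean` (the universal constant of `HexObservableLimitR` is real).
Everything proved. [folklore]
-/

noncomputable section

open Set Complex
open Literature.Probability.RandomPlanarGeometry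
open Literature.Probability.LatticeModels Literature.Probability.RandomPlanarGeometry.SAW

namespace Summit.CriticalPhenomena.SAWScalingLimit.Theorems.HexObservableLimitR.Negative

open BoundaryClosure.Negative

/-! ### The plane reflection `τ z = -conj z` -/

/-- The reflection in the imaginary axis. [folklore] -/
def τ (z : ℂ) : ℂ := -(starRingEnd ℂ) z

/-- The reflection negates the real part. [folklore] -/
@[simp] theorem τ_re (z : ℂ) : (τ z).re = -z.re := by simp [τ]
/-- The reflection keeps the imaginary part. [folklore] -/
@[simp] theorem τ_im (z : ℂ) : (τ z).im = z.im := by simp [τ]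
/-- The reflection is involutive (pointwise). [folklore] -/
@[simp] theorem τ_τ (z : ℂ) : τ (τ z) = z := by simp [τ]

/-- `τ` is an involution. [folklore] -/
theorem τ_involutive : Function.Involutive τ := τ_τ

/-- `τ` is additive up to sign conventions: `τ (z - w) = τ z - τ w`. [folklore] -/
theorem τ_sub (z w : ℂ) : τ (z - w) = τ z - τ w := by simp [τ]; ring

/-- The reflection is additive. [folklore] -/
theorem τ_add (z w : ℂ) : τ (z + w) = τ z + τ w := by simp [τ]; ring

/-- `τ` commutes with real scalars. [folklore] -/
theorem τ_real_mul (r : ℝ) (z : ℂ) : τ ((r : ℂ) * z) = (r : ℂ) * τ z := by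
  simp [τ, Complex.conj_ofReal]

/-- The reflection negates real numbers. [folklore] -/
@[simp] theorem τ_ofReal (r : ℝ) : τ (r : ℂ) = -(r : ℂ) := by simp [τ, Complex.conj_ofReal]

/-- The reflection fixes `0`. [folklore] -/
@[simp] theorem τ_zero : τ 0 = 0 := by simp [τ]

/-- `τ` is an isometry. [folklore] -/
@[simp] theorem norm_τ (z : ℂ) : ‖τ z‖ = ‖z‖ := by simp [τ]

/-- The reflection preserves distances. [folklore] -/
theorem dist_τ (z w : ℂ) : dist (τ z) (τ w) = dist z w := by
  rw [dist_eq_norm, dist_eq_norm, ← τ_sub, norm_τ]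

/-- `τ` is continuous. [folklore] -/
theorem continuous_τ : Continuous τ := (Complex.continuous_conj).neg

/-- `τ` as a homeomorphism of the plane. [folklore] -/
def τHomeo : ℂ ≃ₜ ℂ where
  toFun := τ
  invFun := τ
  left_inv := τ_τ
  right_inv := τ_τ
  continuous_toFun := continuous_τ
  continuous_invFun := continuous_τ

/-- `τHomeo` is `τ`. [folklore] -/
@[simp] theorem τHomeo_apply (z : ℂ) : τHomeo z = τ z := rfl

/-- `τ` maps balls to balls. [folklore] -/
theorem τ_mem_ball_iff {z c : ℂ} {ρ : ℝ} : τ z ∈ Metric.ball (τ c) ρ ↔ z ∈ Metric.ball c ρ := by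
  rw [Metric.mem_ball, Metric.mem_ball, dist_τ]

/-! ### The lattice involution `σ` -/

/-- **The row-preserving lattice reflection**: `σ (fj j r) = fj (-j - 2r - 2) r`. [folklore] -/
def σ (v : HexVertex) : HexVertex := fj (-(jOf v) - 2 * rOf v - 2) (rOf v)

/-- `σ` in coordinates. [folklore] -/
theorem σ_fj (j r : ℤ) : σ (fj j r) = fj (-j - 2 * r - 2) r := by simp [σ]

/-- `σ` is involutive (pointwise). [folklore] -/
@[simp] theorem σ_σ (v : HexVertex) : σ (σ v) = v := by
  conv_rhs => rw [← fj_jOf_rOf v]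
  rw [σ, σ, jOf_fj, rOf_fj]
  congr 1; ring

/-- `σ` is an involution. [folklore] -/
theorem σ_involutive : Function.Involutive σ := σ_σ
/-- `σ` is injective. [folklore] -/
theorem σ_injective : Function.Injective σ := σ_involutive.injective
/-- `σ` is bijective. [folklore] -/
theorem σ_bijective : Function.Bijective σ := σ_involutive.bijective

/-- `σ` as an embedding (for `Finset.map`). [folklore] -/
def σE : HexVertex ↪ HexVertex := ⟨σ, σ_injective⟩

/-- `σE` is `σ`. [folklore] -/
@[simp] theorem σE_apply (v : HexVertex) : σE v = σ v := rfl

/-- **`σ` fixes the row.** [folklore] -/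
@[simp] theorem row_σ (v : HexVertex) : (σ v).1 1 = v.1 1 := by
  rw [σ, fj_fst_one]; rfl

/-- `σ` fixes the row coordinate `rOf`. [folklore] -/
theorem rOf_σ (v : HexVertex) : rOf (σ v) = rOf v := row_σ v

/-- The row-order index of `σ v`. [folklore] -/
theorem jOf_σ (v : HexVertex) : jOf (σ v) = -(jOf v) - 2 * rOf v - 2 := by rw [σ, jOf_fj]

/-- **`σ` is the reflection `τ` on face centres.** [folklore] -/
theorem hexCenter_σ (v : HexVertex) : hexCenter (σ v) = τ (hexCenter v) := by
  conv_rhs => rw [← fj_jOf_rOf v]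
  rw [σ]
  set j := jOf v; set r := rOf v
  apply Complex.ext
  · rw [τ_re, re_hexCenter_fj, re_hexCenter_fj]; push_cast; ring
  · rw [τ_im, im_hexCenter_fj, im_hexCenter_fj]
    have : (-j - 2 * r - 2) % 2 = j % 2 := by omega
    rw [this]

/-- **`σ` is a graph automorphism of the honeycomb lattice.** [folklore] -/
theorem adj_σ_iff (u v : HexVertex) : hexGraph.Adj (σ u) (σ v) ↔ hexGraph.Adj u v := by
  conv_rhs => rw [← fj_jOf_rOf u, ← fj_jOf_rOf v]
  rw [σ, σ, adj_fj_iff, adj_fj_iff]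
  set j := jOf u; set r := rOf u; set j' := jOf v; set r' := rOf v
  have h1 : (-j - 2 * r - 2) % 2 = j % 2 := by omega
  rw [h1]
  constructor
  · rintro (⟨h, h'⟩ | ⟨h, h', h''⟩ | ⟨h, h', h''⟩)
    · left; exact ⟨h, by omega⟩
    · right; left; exact ⟨h, h', by omega⟩
    · right; right; exact ⟨h, h', by omega⟩
  · rintro (⟨h, h'⟩ | ⟨h, h', h''⟩ | ⟨h, h', h''⟩)
    · left; exact ⟨h, by omega⟩
    · right; left; exact ⟨h, h', by omega⟩
    · right; right; exact ⟨h, h', by omega⟩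

/-- `σ` maps adjacent faces to adjacent faces. [folklore] -/
theorem adj_σ {u v : HexVertex} (h : hexGraph.Adj u v) : hexGraph.Adj (σ u) (σ v) := (adj_σ_iff u v).2 h

/-- `σ` as a graph automorphism. [folklore] -/
def σIso : hexGraph ≃g hexGraph where
  toEquiv := σ_involutive.toPerm σ
  map_rel_iff' := adj_σ_iff _ _

/-! ### Mid-edges -/

/-- **Midpoints commute with the reflection.** [folklore] -/
theorem hexMidpoint_map_σ (e : Sym2 HexVertex) : hexMidpoint (e.map σ) = τ (hexMidpoint e) := by
  induction e using Sym2.ind with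
  | h u v =>
    rw [Sym2.map_mk, hexMidpoint_mk, hexMidpoint_mk, hexCenter_σ, hexCenter_σ]
    apply Complex.ext
    · simp only [Complex.div_ofNat_re, Complex.add_re, τ_re]; ring
    · simp only [Complex.div_ofNat_im, Complex.add_im, τ_im]

/-- `Sym2.map σ` is involutive (pointwise). [folklore] -/
@[simp] theorem map_σ_map_σ (e : Sym2 HexVertex) : (e.map σ).map σ = e := by
  rw [Sym2.map_map, show σ ∘ σ = id from funext σ_σ, Sym2.map_id]; rfl

/-- `Sym2.map σ` is injective. [folklore] -/
theorem map_σ_injective : Function.Injective (Sym2.map σ) := Sym2.map.injective σ_injective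

/-- `Sym2.map σ` preserves the edge set of the honeycomb lattice. [folklore] -/
theorem mem_edgeSet_map_σ_iff (e : Sym2 HexVertex) : e.map σ ∈ hexGraph.edgeSet ↔ e ∈ hexGraph.edgeSet := by
  induction e using Sym2.ind with
  | h u v => rw [Sym2.map_mk, SimpleGraph.mem_edgeSet, SimpleGraph.mem_edgeSet, adj_σ_iff]

/-! ### Vertex sets -/

/-- Membership in the reflected vertex set. [folklore] -/
theorem mem_map_σE_iff {Λ : Finset HexVertex} {v : HexVertex} : v ∈ Λ.map σE ↔ σ v ∈ Λ := by
  rw [Finset.mem_map]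
  constructor
  · rintro ⟨u, hu, rfl⟩; simpa using hu
  · intro h; exact ⟨σ v, h, by simp⟩

/-- Membership of `σ v` in the reflected vertex set. [folklore] -/
theorem σ_mem_map_σE_iff {Λ : Finset HexVertex} {v : HexVertex} : σ v ∈ Λ.map σE ↔ v ∈ Λ := by
  rw [mem_map_σE_iff, σ_σ]

/-- Reflecting a vertex set twice gives it back. [folklore] -/
@[simp] theorem map_σE_map_σE (Λ : Finset HexVertex) : (Λ.map σE).map σE = Λ := by
  ext v; rw [mem_map_σE_iff, σ_mem_map_σE_iff]

/-- The reflected vertex set as the image under `σ`. [folklore] -/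
theorem coe_map_σE (Λ : Finset HexVertex) : ((Λ.map σE : Finset HexVertex) : Set HexVertex) = σ '' (Λ : Set HexVertex) := by
  ext v; rw [Finset.mem_coe, mem_map_σE_iff, Set.mem_image]
  constructor
  · intro h; exact ⟨σ v, h, σ_σ v⟩
  · rintro ⟨u, hu, rfl⟩; simpa using hu

/-- The complement of the reflected vertex set is the reflected complement. [folklore] -/
theorem compl_coe_map_σE (Λ : Finset HexVertex) :
    ((Λ.map σE : Finset HexVertex) : Set HexVertex)ᶜ = σ '' ((Λ : Set HexVertex)ᶜ) := by
  rw [coe_map_σE, Set.image_compl_eq σ_bijective]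

/-- **Domain mid-edges are transported by `σ`.** [folklore] -/
theorem mem_hexDomainMidEdges_map_iff (Λ : Finset HexVertex) (e : Sym2 HexVertex) :
    e.map σ ∈ hexDomainMidEdges (Λ.map σE) ↔ e ∈ hexDomainMidEdges Λ := by
  constructor
  · rintro ⟨he, w, hw, hwΛ⟩
    obtain ⟨v, hv, rfl⟩ := Sym2.mem_map.1 hw
    exact ⟨(mem_edgeSet_map_σ_iff e).1 he, v, hv, σ_mem_map_σE_iff.1 hwΛ⟩
  · rintro ⟨he, v, hv, hvΛ⟩
    exact ⟨(mem_edgeSet_map_σ_iff e).2 he, σ v, Sym2.mem_map.2 ⟨v, hv, rfl⟩, σ_mem_map_σE_iff.2 hvΛ⟩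

/-- **Boundary mid-edges are transported by `σ`.** [folklore] -/
theorem mem_hexDomainBoundary_map_iff (Λ : Finset HexVertex) (e : Sym2 HexVertex) :
    e.map σ ∈ hexDomainBoundary (Λ.map σE) ↔ e ∈ hexDomainBoundary Λ := by
  constructor
  · rintro ⟨he, u, v, huv, hv, hu⟩
    refine ⟨(mem_edgeSet_map_σ_iff e).1 he, σ u, σ v, ?_, mem_map_σE_iff.1 hv, fun h => hu (mem_map_σE_iff.2 h)⟩
    have := congrArg (Sym2.map σ) huv
    rwa [map_σ_map_σ, Sym2.map_mk] at this
  · rintro ⟨he, u, v, rfl, hv, hu⟩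
    exact ⟨(mem_edgeSet_map_σ_iff _).2 he, σ u, σ v, by rw [Sym2.map_mk], σ_mem_map_σE_iff.2 hv,
      fun h => hu (σ_mem_map_σE_iff.1 h)⟩

/-! ### Connectivity -/

/-- **Connectivity of induced subgraphs is transported by `σ`.** [folklore] -/
theorem preconnected_induce_image_σ {S : Set HexVertex} (h : (hexGraph.induce S).Preconnected) :
    (hexGraph.induce (σ '' S)).Preconnected := by
  let f : hexGraph.induce S →g hexGraph.induce (σ '' S) :=
    { toFun := fun v => ⟨σ v, v, v.2, rfl⟩
      map_rel' := fun {u v} huv => by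
        simp only [SimpleGraph.induce_adj] at huv ⊢
        exact adj_σ huv }
  refine h.map f ?_
  rintro ⟨w, v, hv, rfl⟩
  exact ⟨⟨v, hv⟩, rfl⟩

/-- **Simple connectivity is transported by `σ`.** [folklore] -/
theorem hexDomainSimplyConnected_map_σ {Λ : Finset HexVertex} (h : hexDomainSimplyConnected Λ) :
    hexDomainSimplyConnected (Λ.map σE) := by
  unfold hexDomainSimplyConnected at h ⊢
  rw [compl_coe_map_σE]
  exact preconnected_induce_image_σ h

/-- Connectivity of the vertex set is transported by `σ`. [folklore] -/
theorem preconnected_map_σ {Λ : Finset HexVertex}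
    (h : (hexGraph.induce ((Λ : Finset HexVertex) : Set HexVertex)).Preconnected) :
    (hexGraph.induce ((Λ.map σE : Finset HexVertex) : Set HexVertex)).Preconnected := by
  rw [coe_map_σE]
  exact preconnected_induce_image_σ h

/-! ### Finiteness of the domain mid-edges -/

/-- The neighbours of a face, as a finite list of candidates. [folklore] -/
theorem adj_fj_subset (j r : ℤ) {w : HexVertex} (h : hexGraph.Adj (fj j r) w) :
    w ∈ ({fj (j + 1) r, fj (j - 1) r, fj (j + 1) (r - 1), fj (j - 1) (r + 1)} : Set HexVertex) := by
  rw [← fj_jOf_rOf w, adj_fj_iff] at h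
  rw [← fj_jOf_rOf w]
  set j' := jOf w; set r' := rOf w
  simp only [Set.mem_insert_iff, Set.mem_singleton_iff, fj_inj]
  omega

/-- **The set of domain mid-edges of a finite vertex set is finite.** [folklore] -/
theorem finite_hexDomainMidEdges (Λ : Finset HexVertex) : (hexDomainMidEdges Λ).Finite := by
  have hsub : hexDomainMidEdges Λ ⊆ ⋃ v ∈ (Λ : Set HexVertex),
      (fun w => s(v, w)) '' {w | hexGraph.Adj v w} := by
    rintro e ⟨he, v, hv, hvΛ⟩
    simp only [Set.mem_iUnion, Set.mem_image, Set.mem_setOf_eq]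
    induction e using Sym2.ind with
    | h x y =>
      rw [SimpleGraph.mem_edgeSet] at he
      rcases Sym2.mem_iff.1 hv with rfl | rfl
      · exact ⟨v, hvΛ, y, he, rfl⟩
      · exact ⟨v, hvΛ, x, he.symm, Sym2.eq_swap⟩
  refine Set.Finite.subset ?_ hsub
  refine Set.Finite.biUnion (Finset.finite_toSet Λ) fun v _ => Set.Finite.image _ ?_
  rw [← fj_jOf_rOf v]
  exact (Set.toFinite _).subset fun w hw => adj_fj_subset _ _ hw

end Summit.CriticalPhenomena.SAWScalingLimit.Theorems.HexObservableLimitR.Negative
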